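import Summits.ABC.IUTFork.LDHSplitBadWitnessPoles
import Literature.IUT.LogVolume.Theorem110RealStepII
import Literature.IUT.LogVolume.PilotSlotResidueBounds
import HarnessLib

/-!
# The fork at [IUTchIII] Corollary 3.12, L-DH level: ADMISSIBLE points ON the split-bad locus — III. Conjugate places,
# the split-bad condition `Σ_{V | p} 𝟙_bad·Pr(V) ≤ 1/2`, the height `log q^∀(λ_m) ≥ log(1 + 4^{m+1})`, `AdmitsCore`, (P5)

Proof-only file (D-0012; 0 definitions, no `Prop` fact) of the abc-iut cell (seat abc-iut-w5-d126), sequel of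
`LDHSplitBadWitnessPoint.lean` / `LDHSplitBadWitnessPoles.lean`. TAKES NO SIDE on [IUTchIII] Cor. 3.12 or [IUTchIV]
Thm. 1.10; classical arithmetic of `ℚ(i)`. S. Mochizuki, *IUT IV* [Mochizuki2012], Cor. 2.2 (ii) proof pp. 43–46
(«admits an `F`-core», (P5)); [MochizukiGenEll2010] §1 p. 4 (product formula), Ex. 1.3 (ii) p. 5; Dupuy–Hilado
[DupuyHilado2025] §3.6 (weights `Pr(v) = n_v/[F:ℚ]`); [IrelandRosen1982] Ch. 9 §7 p. 120; [NeukirchANT1999] Ch. I §8 (8.2).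

For `ζ = i ∈ 𝓞 F`, an automorphism `τ` of `𝓞 F` with `τ ζ = −ζ` and `τ² = 1` (complex conjugation, which exists:
`exists_conj`), and a finite place `V`, the CONJUGATE PLACE is Mathlib's `HeightOneSpectrum.comap τ V` (`x ∈ V̄ ⟺ τ x ∈ V`):
* `V̄` has the residue characteristic, local degree and weight `Pr` of `V` (`τ` is an automorphism over `ℤ`:
  `Ideal.ramificationIdx'_comap_eq` / `inertiaDeg'_comap_eq`), lies over the same `p`, and `V̄̄ = V`;
* an ODD bad place of `P_m` and its conjugate are never both bad (`notMem_badPlaces_comap`, from part II);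
* **`sum_indicator_weight_le_half`** — the SPLIT-BAD POINT CONDITION: for every `S ∋ 2` and prime `p`,
  `Σ_{V ∈ V(F)_p} 𝟙[V ∈ badPlacesAvoid P_m S]·Pr(V) ≤ 1/2` (conjugation is a `Pr`-preserving involution of `V(F)_p`
  carrying bad places to non-bad ones; `Σ_{V|p} Pr(V) = 1`);
* **`log_le_logQForall`** — `log(1 + 4^{m+1}) ≤ log q^∀(P_m)` (places above `1 + i2^{m+1}` are bad with local height
  `2·ord_V`; product formula from part I; `deg P_m = 2`), and `m + 1 ≤ log(1 + 4^{m+1})`;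
* **`admitsCore`** — `j(λ_m)` is none of the four exceptional RATIONAL values: a rational value would have a
  conjugation-symmetric pole set (`ord_V(q) < 0 ⟺ q.den ∈ V ⟺ q.den ∈ V̄`), but the pole above `1 + i2^{m+1}` is odd;
* **`condP5`** — (P5) at every prime `l > 1 + 4^{m+1}`: a place above `1 + i2^{m+1}` is a pole dividing neither `2` nor `l`.
HONEST SCOPE: classical; nothing asserted about print. [claim: Mochizuki2012, status: disputed] for every IUT locator.
-/

noncomputable section

namespace Summit.ABC.IUTFork

namespace SplitBadWitness

open NumberField IsDedekindDomain Finset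
open Literature.IUT.LogVolume Literature.IUT.LogVolume.Cor22
open Literature.NumberTheory.DiophantineGeometry Literature.NumberTheory.DiophantineGeometry.GenEll
open Literature.NumberTheory.NumberFields

variable {F : Type} [Field F] [NumberField F] {ζ : 𝓞 F}

/-! ## Conjugate places along an automorphism `τ` of `𝓞 F` -/

/-- **Complex conjugation on `ℤ[i]`**: an automorphism `τ` of `𝓞 F` over `ℤ` with `τ i = −i` and `τ² = 1`
(`galRestrict` of the non-trivial element of `Gal(ℚ(i)/ℚ)`). [cite: IrelandRosen1982, Ch. 9 §7 p. 120] -/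
theorem exists_conj [IsCyclotomicExtension {4} ℚ F] (hζ : IsPrimitiveRoot ζ 4) :
    ∃ τ : 𝓞 F ≃ₐ[ℤ] 𝓞 F, τ ζ = -ζ ∧ ∀ x, τ (τ x) = x := by
  obtain ⟨σ, hσ⟩ := exists_algEquiv_ne_one_four (K := F)
  refine ⟨galRestrict ℤ ℚ F (𝓞 F) σ, galRestrict_apply_eq_neg_four hσ hζ, fun x => ?_⟩
  have h : galRestrict ℤ ℚ F (𝓞 F) σ * galRestrict ℤ ℚ F (𝓞 F) σ = 1 := by
    rw [← map_mul (galRestrict ℤ ℚ F (𝓞 F)) σ σ, algEquiv_mul_self_four σ, map_one]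
  have := congrArg (fun f : 𝓞 F ≃ₐ[ℤ] 𝓞 F => f x) h
  simpa [AlgEquiv.mul_apply] using this

omit [NumberField F] in
/-- Membership in the conjugate place: `x ∈ V̄ ⟺ τ x ∈ V`. [cite: IrelandRosen1982, Ch. 9 §7 p. 120] -/
theorem mem_comap_iff (τ : 𝓞 F ≃ₐ[ℤ] 𝓞 F) (V : HeightOneSpectrum (𝓞 F)) (x : 𝓞 F) :
    x ∈ (HeightOneSpectrum.comap (τ : 𝓞 F →+* 𝓞 F) τ.surjective V).asIdeal ↔ τ x ∈ V.asIdeal := by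
  rw [HeightOneSpectrum.comap_asIdeal, Ideal.mem_comap]; rfl

omit [NumberField F] in
/-- Rational integers: `n ∈ V̄ ⟺ n ∈ V`. [cite: IrelandRosen1982, Ch. 9 §7 p. 120] -/
theorem natCast_mem_comap_iff (τ : 𝓞 F ≃ₐ[ℤ] 𝓞 F) (V : HeightOneSpectrum (𝓞 F)) (n : ℕ) :
    (n : 𝓞 F) ∈ (HeightOneSpectrum.comap (τ : 𝓞 F →+* 𝓞 F) τ.surjective V).asIdeal ↔ (n : 𝓞 F) ∈ V.asIdeal := by
  rw [mem_comap_iff, map_natCast]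

omit [NumberField F] in
/-- `V̄̄ = V` for an involution `τ`. [cite: IrelandRosen1982, Ch. 9 §7 p. 120] -/
theorem comap_comap (τ : 𝓞 F ≃ₐ[ℤ] 𝓞 F) (hττ : ∀ x, τ (τ x) = x) (V : HeightOneSpectrum (𝓞 F)) :
    HeightOneSpectrum.comap (τ : 𝓞 F →+* 𝓞 F) τ.surjective
      (HeightOneSpectrum.comap (τ : 𝓞 F →+* 𝓞 F) τ.surjective V) = V := by
  ext x
  rw [mem_comap_iff, mem_comap_iff, hττ]

omit [NumberField F] in
/-- `V̄` and `V` have the same residue characteristic. [cite: NeukirchANT1999, Ch. I §8 Prop. (8.2)] -/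
theorem residueChar_comap (τ : 𝓞 F ≃ₐ[ℤ] 𝓞 F) (V : HeightOneSpectrum (𝓞 F)) :
    residueChar F (HeightOneSpectrum.comap (τ : 𝓞 F →+* 𝓞 F) τ.surjective V) = residueChar F V := by
  unfold residueChar
  congr 1
  ext z
  change z ∈ Ideal.comap (algebraMap ℤ (𝓞 F)) (HeightOneSpectrum.comap (τ : 𝓞 F →+* 𝓞 F) τ.surjective V).asIdeal ↔
    z ∈ Ideal.comap (algebraMap ℤ (𝓞 F)) V.asIdeal
  rw [Ideal.mem_comap, Ideal.mem_comap, mem_comap_iff, AlgEquiv.commutes]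

/-- `Pr(V̄) = Pr(V)` (`τ` is an automorphism over `ℤ`, so `e` and `f` agree). [cite: NeukirchANT1999, Ch. I §8 Prop. (8.2)] [cite: DupuyHilado2025, §3.6] -/
theorem weight_comap (τ : 𝓞 F ≃ₐ[ℤ] 𝓞 F) (V : HeightOneSpectrum (𝓞 F)) :
    weight F (HeightOneSpectrum.comap (τ : 𝓞 F →+* 𝓞 F) τ.surjective V) = weight F V := by
  unfold weight localDegree ramIdx resDeg
  rw [residueChar_comap, HeightOneSpectrum.comap_asIdeal]
  change ((Ideal.ramificationIdx' _ (V.asIdeal.comap τ) * Ideal.inertiaDeg' _ (V.asIdeal.comap τ) : ℕ) : ℝ) / _ = _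
  rw [Ideal.ramificationIdx'_comap_eq, Ideal.inertiaDeg'_comap_eq]

/-- `V̄ ∣ p ⟺ V ∣ p`. [cite: NeukirchANT1999, Ch. I §8 Prop. (8.2)] -/
theorem comap_mem_placesOver_iff (τ : 𝓞 F ≃ₐ[ℤ] 𝓞 F) {p : ℕ} [Fact p.Prime] (V : HeightOneSpectrum (𝓞 F)) :
    HeightOneSpectrum.comap (τ : 𝓞 F →+* 𝓞 F) τ.surjective V ∈ placesOver F p ↔ V ∈ placesOver F p := by
  rw [mem_placesOver_iff_residueChar, mem_placesOver_iff_residueChar, residueChar_comap]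

/-- **Conjugation carries odd bad places of `P_m` to non-bad places** (part II's cross lemma: `τ(1 + i2^k) = 1 − i2^k`).
[cite: IrelandRosen1982, Ch. 9 §7 p. 120] [claim: Mochizuki2012, status: disputed] -/
theorem notMem_badPlaces_comap (hζ : IsPrimitiveRoot ζ 4) (τ : 𝓞 F ≃ₐ[ℤ] 𝓞 F) (hτ : τ ζ = -ζ) (m : ℕ)
    (V : HeightOneSpectrum (𝓞 F)) (hV : (2 : 𝓞 F) ∉ V.asIdeal)
    (hbad : V ∈ badPlaces (⟨F, (ζ : F) * 2 ^ m / (1 + (ζ : F) * 2 ^ (m + 1))⟩ : NFPoint)) :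
    HeightOneSpectrum.comap (τ : 𝓞 F →+* 𝓞 F) τ.surjective V ∉
      badPlaces (⟨F, (ζ : F) * 2 ^ m / (1 + (ζ : F) * 2 ^ (m + 1))⟩ : NFPoint) := by
  intro hbad'
  have hV' : (2 : 𝓞 F) ∉ (HeightOneSpectrum.comap (τ : 𝓞 F →+* 𝓞 F) τ.surjective V).asIdeal := by
    rw [mem_comap_iff, map_ofNat]; exact hV
  have h1 := mem_or_mem_of_mem_badPlaces hζ m V hV hbad
  have h2 := mem_or_mem_of_mem_badPlaces hζ m _ hV' hbad'
  rw [mem_comap_iff, mem_comap_iff] at h2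
  simp only [map_add, map_one, map_mul, map_pow, map_ofNat, hτ, neg_mul, ← sub_eq_add_neg] at h2
  exact hV (two_mem_of_mem_of_mem hζ m V.asIdeal h1 h2)

/-! ## The split-bad point condition -/

open scoped Classical in
/-- **The split-bad point condition for `P_m`.** For every finite set `S` of primes with `2 ∈ S` and every prime `p`:
`Σ_{V ∈ V(F)_p} 𝟙[V ∈ badPlacesAvoid P_m S]·Pr(V) ≤ 1/2`. Conjugation `τ` is a `Pr`-preserving involution of `V(F)_p`
carrying each (odd) bad place to a non-bad one, and `Σ_{V | p} Pr(V) = 1`. [cite: Mochizuki2012, IUTchIV Cor 2.2 (ii) proof (P5) p.46]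
[claim: Mochizuki2012, status: disputed] [cite: DupuyHilado2025, §3.6] -/
theorem sum_indicator_weight_le_half [IsCyclotomicExtension {4} ℚ F] (hζ : IsPrimitiveRoot ζ 4) (m : ℕ)
    (S : Finset ℕ) (hS : 2 ∈ S) (p : ℕ) [Fact p.Prime] :
    ∑ V : placesOver F p,
        ((badPlacesAvoid (⟨F, (ζ : F) * 2 ^ m / (1 + (ζ : F) * 2 ^ (m + 1))⟩ : NFPoint) S : Finset _) :
          Set (HeightOneSpectrum (𝓞 F))).indicator (weight F) V.1 ≤ 1 / 2 := by
  classical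
  obtain ⟨τ, hτ, hττ⟩ := exists_conj hζ
  set Pm : NFPoint := ⟨F, (ζ : F) * 2 ^ m / (1 + (ζ : F) * 2 ^ (m + 1))⟩ with hPm
  set B : Set (HeightOneSpectrum (𝓞 F)) := ((badPlacesAvoid Pm S : Finset _) : Set (HeightOneSpectrum (𝓞 F)))
  set f : placesOver F p → ℝ := fun V => B.indicator (weight F) V.1
  -- the involution of `V(F)_p`
  let c : placesOver F p → placesOver F p := fun V =>
    ⟨HeightOneSpectrum.comap (τ : 𝓞 F →+* 𝓞 F) τ.surjective V.1, (comap_mem_placesOver_iff τ V.1).mpr V.2⟩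
  have hcc : ∀ V, c (c V) = V := fun V => Subtype.ext (comap_comap τ hττ V.1)
  let ce : placesOver F p ≃ placesOver F p := ⟨c, c, hcc, hcc⟩
  have hB : ∀ V : HeightOneSpectrum (𝓞 F), V ∈ B → (2 : 𝓞 F) ∉ V.asIdeal ∧ V ∈ badPlaces Pm := by
    intro V hV
    have hV' : V ∈ badPlacesAvoid Pm S := by simpa [B] using hV
    unfold badPlacesAvoid at hV'
    rw [Finset.mem_filter] at hV'
    have h2 := hV'.2 2 hS
    rw [Nat.cast_ofNat] at h2
    exact ⟨h2, hV'.1⟩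
  have hnot : ∀ V : HeightOneSpectrum (𝓞 F), V ∈ B →
      HeightOneSpectrum.comap (τ : 𝓞 F →+* 𝓞 F) τ.surjective V ∉ B := by
    intro V hV hcV
    obtain ⟨h2, hbad⟩ := hB V hV
    obtain ⟨-, hbad'⟩ := hB _ hcV
    exact notMem_badPlaces_comap hζ τ hτ m V h2 hbad hbad'
  have hsum : ∑ V : placesOver F p, f (ce V) = ∑ V : placesOver F p, f V := Equiv.sum_comp ce f
  have hpt : ∀ V : placesOver F p, f V + f (ce V) ≤ weight F V.1 := by
    intro V
    change B.indicator (weight F) V.1 +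
      B.indicator (weight F) (HeightOneSpectrum.comap (τ : 𝓞 F →+* 𝓞 F) τ.surjective V.1) ≤ weight F V.1
    by_cases hV : V.1 ∈ B
    · rw [Set.indicator_of_mem hV, Set.indicator_of_notMem (hnot V.1 hV), add_zero]
    · rw [Set.indicator_of_notMem hV, zero_add]
      by_cases hc : HeightOneSpectrum.comap (τ : 𝓞 F →+* 𝓞 F) τ.surjective V.1 ∈ B
      · rw [Set.indicator_of_mem hc, weight_comap]
      · rw [Set.indicator_of_notMem hc]; exact weight_nonneg F V.1
  have h2 : 2 * ∑ V : placesOver F p, f V ≤ ∑ V : placesOver F p, weight F V.1 := by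
    rw [two_mul]
    nth_rw 2 [← hsum]
    rw [← Finset.sum_add_distrib]
    exact Finset.sum_le_sum fun V _ => hpt V
  rw [PilotData.sum_weight_placesOver (F := F) p] at h2
  change ∑ V : placesOver F p, f V ≤ 1 / 2
  linarith

/-! ## The height: `log q^∀(P_m) ≥ log(1 + 4^{m+1}) ≥ m + 1` -/

/-- **`log(1 + 4^{m+1}) ≤ log q^∀(P_m)`**: the places above `1 + i2^{m+1}` are bad with local height `2·ord_V(1 + i2^{m+1})`,
and `Σ_V ord_V(1 + i2^{m+1})·log N V = log(1 + 4^{m+1})` (product formula), `deg P_m = 2`.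
[cite: Mochizuki2012, IUTchIV Cor 2.2 (i) p.41] [claim: Mochizuki2012, status: disputed] [cite: MochizukiGenEll2010, §1 p.4] -/
theorem log_le_logQForall [IsCyclotomicExtension {4} ℚ F] (hζ : IsPrimitiveRoot ζ 4) (m : ℕ) :
    Real.log (1 + 4 ^ (m + 1)) ≤ logQForall (⟨F, (ζ : F) * 2 ^ m / (1 + (ζ : F) * 2 ^ (m + 1))⟩ : NFPoint) := by
  classical
  set T := (finite_setOf_ord_ne_zero F (1 + (ζ : F) * 2 ^ (m + 1))).toFinset with hT
  have hTmem : ∀ V ∈ T, 1 + ζ * 2 ^ (m + 1) ∈ V.asIdeal := by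
    intro V hV
    rw [hT, Set.Finite.mem_toFinset, Set.mem_setOf_eq] at hV
    have h0 : 0 ≤ ord F V (1 + (ζ : F) * 2 ^ (m + 1)) := by
      rw [← coe_one_add]; exact ord_nonneg_of_isIntegral F V _
    have hpos : 0 < ord F V (((1 + ζ * 2 ^ (m + 1) : 𝓞 F)) : F) := by rw [coe_one_add]; omega
    exact (ord_pos_iff_mem F V _ (one_add_ne_zero hζ (m + 1))).mp hpos
  have hdeg := degree_mul_logQAvoid (⟨F, (ζ : F) * 2 ^ m / (1 + (ζ : F) * 2 ^ (m + 1))⟩ : NFPoint) ∅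
  have hd : (((⟨F, (ζ : F) * 2 ^ m / (1 + (ζ : F) * 2 ^ (m + 1))⟩ : NFPoint).degree : ℕ) : ℝ) = 2 := by
    change ((Module.finrank ℚ F : ℕ) : ℝ) = 2; rw [finrank_eq_two F]; norm_num
  rw [hd] at hdeg
  have hfilter : (badPlaces (⟨F, (ζ : F) * 2 ^ m / (1 + (ζ : F) * 2 ^ (m + 1))⟩ : NFPoint)).filter
      (fun v => ∀ q ∈ (∅ : Finset ℕ), ((q : ℕ) : 𝓞 F) ∉ v.asIdeal) = badPlaces (⟨F, (ζ : F) * 2 ^ m / (1 + (ζ : F) * 2 ^ (m + 1))⟩ : NFPoint) :=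
    Finset.filter_true_of_mem fun v _ => by simp
  rw [hfilter] at hdeg
  change 2 * logQForall (⟨F, (ζ : F) * 2 ^ m / (1 + (ζ : F) * 2 ^ (m + 1))⟩ : NFPoint) = _ at hdeg
  have hsub : T ⊆ badPlaces (⟨F, (ζ : F) * 2 ^ m / (1 + (ζ : F) * 2 ^ (m + 1))⟩ : NFPoint) := fun V hV => mem_badPlaces_of_mem hζ m V (hTmem V hV)
  have hle : ∑ V ∈ T, localHeight (⟨F, (ζ : F) * 2 ^ m / (1 + (ζ : F) * 2 ^ (m + 1))⟩ : NFPoint) V * logNorm F V ≤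
      ∑ V ∈ badPlaces (⟨F, (ζ : F) * 2 ^ m / (1 + (ζ : F) * 2 ^ (m + 1))⟩ : NFPoint), localHeight (⟨F, (ζ : F) * 2 ^ m / (1 + (ζ : F) * 2 ^ (m + 1))⟩ : NFPoint) V * logNorm F V :=
    Finset.sum_le_sum_of_subset_of_nonneg hsub fun V _ _ =>
      mul_nonneg (localHeight_nonneg (⟨F, (ζ : F) * 2 ^ m / (1 + (ζ : F) * 2 ^ (m + 1))⟩ : NFPoint) V) (logNorm_pos F V).le
  have hT' : ∑ V ∈ T, localHeight (⟨F, (ζ : F) * 2 ^ m / (1 + (ζ : F) * 2 ^ (m + 1))⟩ : NFPoint) V * logNorm F V = 2 * Real.log (1 + 4 ^ (m + 1)) := by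
    rw [← sum_ord_mul_logNorm_one_add hζ m, Finset.mul_sum]
    refine Finset.sum_congr rfl fun V hV => ?_
    rw [localHeight_of_mem hζ m V (hTmem V hV)]
    ring
  linarith

omit [Field F] [NumberField F] in
/-- `m + 1 ≤ log(1 + 4^{m+1})` (`log 4 ≥ 1`): the heights of the family are unbounded. [cite: MochizukiGenEll2010, Ex 1.3 (ii) p.5] -/
theorem succ_le_log (m : ℕ) : ((m : ℝ) + 1) ≤ Real.log (1 + 4 ^ (m + 1)) := by
  have h1 : (1 : ℝ) ≤ Real.log 4 := by
    rw [← Real.log_exp 1]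
    exact Real.log_le_log (Real.exp_pos 1) (by have := Real.exp_one_lt_d9; norm_num at this ⊢; linarith)
  have h2 : Real.log (4 ^ (m + 1)) ≤ Real.log (1 + 4 ^ (m + 1)) :=
    Real.log_le_log (by positivity) (by linarith)
  rw [Real.log_pow] at h2
  push_cast at h2
  nlinarith

/-! ## A place above `1 + i2^{m+1}`; `AdmitsCore`; (P5) -/

/-- **There is a finite place `V ∋ 1 + i2^{m+1}`** (`N(1 + i2^{m+1}) = 1 + 4^{m+1} ≠ 1`: not a unit of `ℤ[i]`).
[cite: IrelandRosen1982, Ch. 9 §7 p. 120] -/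
theorem exists_place_mem [IsCyclotomicExtension {4} ℚ F] (hζ : IsPrimitiveRoot ζ 4) (m : ℕ) :
    ∃ V : HeightOneSpectrum (𝓞 F), 1 + ζ * 2 ^ (m + 1) ∈ V.asIdeal := by
  have hnu : ¬ IsUnit (1 + ζ * 2 ^ (m + 1) : 𝓞 F) := by
    rw [isUnit_iff_norm_eq_one_four]
    have h := norm_int_add_int_mul_four hζ 1 (2 ^ (m + 1))
    have e1 : ((1 : ℤ) : 𝓞 F) + ((2 ^ (m + 1) : ℤ) : 𝓞 F) * ζ = 1 + ζ * 2 ^ (m + 1) := by push_cast; ring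
    rw [e1] at h
    rw [h]
    have : (0 : ℤ) < (2 ^ (m + 1)) ^ 2 := by positivity
    linarith
  obtain ⟨M, hM, hle⟩ := Ideal.exists_le_maximal _ (Ideal.span_singleton_ne_top hnu)
  have hmem : (1 + ζ * 2 ^ (m + 1) : 𝓞 F) ∈ M := hle (Ideal.mem_span_singleton_self _)
  refine ⟨⟨M, hM.isPrime, fun hbot => one_add_ne_zero hζ (m + 1) ?_⟩, hmem⟩
  rw [hbot, Ideal.mem_bot] at hmem
  exact hmem

/-- For a rational `q`: if `ord_V(q) < 0` then `ord_V̄(q) < 0` (both say `q.den ∈ V ∩ ℤ = V̄ ∩ ℤ`; `q.num`, `q.den` coprime).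
[cite: NeukirchANT1999, Ch. I §8 Prop. (8.2)] -/
theorem ord_ratCast_comap_neg (τ : 𝓞 F ≃ₐ[ℤ] 𝓞 F) {q : ℚ} (V : HeightOneSpectrum (𝓞 F)) (h : ord F V (q : F) < 0) :
    ord F (HeightOneSpectrum.comap (τ : 𝓞 F →+* 𝓞 F) τ.surjective V) (q : F) < 0 := by
  set W := HeightOneSpectrum.comap (τ : 𝓞 F →+* 𝓞 F) τ.surjective V with hW
  have hq0 : q ≠ 0 := by rintro rfl; simp [ord_zero] at h
  have hnum0 : (q.num : F) ≠ 0 := by exact_mod_cast (Rat.num_ne_zero.mpr hq0)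
  have hden0 : (q.den : F) ≠ 0 := by exact_mod_cast q.den_ne_zero
  have hden0' : ((q.den : ℕ) : 𝓞 F) ≠ 0 := by exact_mod_cast q.den_ne_zero
  have hnum0' : ((q.num : ℤ) : 𝓞 F) ≠ 0 := by exact_mod_cast (Rat.num_ne_zero.mpr hq0)
  have hcn : (((q.num : ℤ) : 𝓞 F) : F) = (q.num : F) := map_intCast _ _
  have hcd : (((q.den : ℕ) : 𝓞 F) : F) = (q.den : F) := map_natCast _ _
  have hordq : ∀ U : HeightOneSpectrum (𝓞 F),
      ord F U (q : F) = ord F U (((q.num : ℤ) : 𝓞 F) : F) - ord F U (((q.den : ℕ) : 𝓞 F) : F) := by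
    intro U
    rw [hcn, hcd, Rat.cast_def, div_eq_mul_inv, ord_mul F U hnum0 (inv_ne_zero hden0), ord_inv]
    ring
  have hnumU : ∀ U : HeightOneSpectrum (𝓞 F), 0 ≤ ord F U (((q.num : ℤ) : 𝓞 F) : F) :=
    fun U => ord_nonneg_of_isIntegral F U _
  have hdenV : ((q.den : ℕ) : 𝓞 F) ∈ V.asIdeal := by
    have h1 : 0 < ord F V (((q.den : ℕ) : 𝓞 F) : F) := by have := hordq V; have := hnumU V; omega
    exact (ord_pos_iff_mem F V _ hden0').mp h1
  have hdenW : ((q.den : ℕ) : 𝓞 F) ∈ W.asIdeal := (natCast_mem_comap_iff τ V q.den).mpr hdenV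
  have hnumW : ((q.num : ℤ) : 𝓞 F) ∉ W.asIdeal := by
    intro hnum
    apply W.isPrime.ne_top
    rw [Ideal.eq_top_iff_one]
    obtain ⟨a, b, hab⟩ := Rat.isCoprime_num_den q
    have : (1 : 𝓞 F) = a * q.num + b * q.den := by exact_mod_cast congrArg (fun z : ℤ => (z : 𝓞 F)) hab.symm
    rw [this]
    exact W.asIdeal.add_mem (W.asIdeal.mul_mem_left _ hnum) (W.asIdeal.mul_mem_left _ (by exact_mod_cast hdenW))
  have h1 : 0 < ord F W (((q.den : ℕ) : 𝓞 F) : F) := (ord_pos_iff_mem F W _ hden0').mpr hdenW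
  have h2 : ord F W (((q.num : ℤ) : 𝓞 F) : F) = 0 := by
    have := hnumU W
    by_contra hne
    exact hnumW ((ord_pos_iff_mem F W _ hnum0').mp (by omega))
  rw [hordq W, h2]
  omega

/-- **`P_m` admits a core**: `j(λ_m)` is none of the four exceptional rational `j`-invariants — a rational value `q` with a
pole at the odd place `V ∋ 1 + i2^{m+1}` would also have a pole at `V̄` (`q.den ∈ V̄`), contradicting
`notMem_badPlaces_comap`. [cite: Mochizuki2012, IUTchIV Cor 2.2 (ii) proof p.43] [claim: Mochizuki2012, status: disputed] -/
theorem admitsCore [IsCyclotomicExtension {4} ℚ F] (hζ : IsPrimitiveRoot ζ 4) (m : ℕ) :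
    AdmitsCore (⟨F, (ζ : F) * 2 ^ m / (1 + (ζ : F) * 2 ^ (m + 1))⟩ : NFPoint) := by
  intro q _ hq
  set Pm : NFPoint := ⟨F, (ζ : F) * 2 ^ m / (1 + (ζ : F) * 2 ^ (m + 1))⟩ with hPm
  change jInv ((ζ : F) * 2 ^ m / (1 + (ζ : F) * 2 ^ (m + 1))) = (q : F) at hq
  obtain ⟨τ, hτ, -⟩ := exists_conj hζ
  obtain ⟨V, hV⟩ := exists_place_mem hζ m
  have h2 : (2 : 𝓞 F) ∉ V.asIdeal := two_notMem_of_mem V.isPrime.ne_top hV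
  have hbad : V ∈ badPlaces Pm := mem_badPlaces_of_mem hζ m V hV
  have hneg : ord F V (q : F) < 0 := by rw [← hq]; exact (mem_badPlaces_iff_ord_neg Pm V).1 hbad
  have hneg' := ord_ratCast_comap_neg τ V hneg
  rw [← hq] at hneg'
  exact notMem_badPlaces_comap hζ τ hτ m V h2 hbad ((mem_badPlaces_iff_ord_neg Pm _).2 hneg')

/-- **(P5) for `P_m` at every prime `l > 1 + 4^{m+1}`**: a place above `1 + i2^{m+1}` is a pole of `j(λ_m)` containing
neither `2` (`(1 + i2^{m+1}) − 2·i2^m = 1`) nor `l` (`l` is coprime to `N(1 + i2^{m+1}) = 1 + 4^{m+1} ∈ V`).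
[cite: Mochizuki2012, IUTchIV Cor 2.2 (ii) proof (P5) p.46] [claim: Mochizuki2012, status: disputed] -/
theorem condP5 [IsCyclotomicExtension {4} ℚ F] (hζ : IsPrimitiveRoot ζ 4) (m : ℕ) {l : ℕ} (hlp : l.Prime)
    (hl : 1 + 4 ^ (m + 1) < l) : CondP5 (⟨F, (ζ : F) * 2 ^ m / (1 + (ζ : F) * 2 ^ (m + 1))⟩ : NFPoint) l := by
  obtain ⟨V, hV⟩ := exists_place_mem hζ m
  refine ⟨V, ?_, ?_, ?_⟩
  · change ord F V (jInv ((ζ : F) * 2 ^ m / (1 + (ζ : F) * 2 ^ (m + 1)))) < 0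
    exact (mem_badPlaces_iff_ord_neg (⟨F, (ζ : F) * 2 ^ m / (1 + (ζ : F) * 2 ^ (m + 1))⟩ : NFPoint) V).1
      (mem_badPlaces_of_mem hζ m V hV)
  · change ((2 : ℕ) : 𝓞 F) ∉ V.asIdeal
    rw [Nat.cast_ofNat]
    exact two_notMem_of_mem V.isPrime.ne_top hV
  · change ((l : ℕ) : 𝓞 F) ∉ V.asIdeal
    intro hlV
    apply V.isPrime.ne_top
    rw [Ideal.eq_top_iff_one]
    have hN : ((1 + 4 ^ (m + 1) : ℕ) : 𝓞 F) ∈ V.asIdeal := by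
      rw [← one_add_mul_one_sub hζ]; exact V.asIdeal.mul_mem_right _ hV
    have hcop : Nat.Coprime l (1 + 4 ^ (m + 1)) :=
      (Nat.Prime.coprime_iff_not_dvd hlp).mpr (Nat.not_dvd_of_pos_of_lt (by positivity) hl)
    obtain ⟨a, b, hab⟩ := Nat.isCoprime_iff_coprime.mpr hcop
    have : (1 : 𝓞 F) = a * (l : ℕ) + b * ((1 + 4 ^ (m + 1) : ℕ) : ℤ) := by
      exact_mod_cast congrArg (fun z : ℤ => (z : 𝓞 F)) hab.symm
    rw [this]
    push_cast
    refine V.asIdeal.add_mem (V.asIdeal.mul_mem_left _ hlV) (V.asIdeal.mul_mem_left _ ?_)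
    exact_mod_cast hN

end SplitBadWitness

end Summit.ABC.IUTFork

end
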